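import Literature.Combinatorics.Optimization.ShellLawTypeStep
import HarnessLib

/-!
# Pinning two full edges: the shell average of a block statistic tilted by `x_v x_{πv} x_w x_{πw}`

Fix a perfect matching (`π` its partner involution), a `π`-stable ground set `S`, a block `H`, two vertices
`v, w` on distinct edges. For the cell's tilted masks `ψ(|U∩H|)·C_u(U)²` with
`C_u(U) = Σ_p u_p·[p ∈ U][πp ∈ U]` (prover bricks 103/113b: the (CG_1′) containment form), expanding the square
gives terms `ψ(|U∩H|)·[e_v ⊆ U]·[e_w ⊆ U]`; conditioned on the two edges being FULL, the rest of the cut is a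
uniform member of the shell of the doubly-deleted ground set `S ∖ e_v ∖ e_w` at cut size `t − 4` and the same
level, and `|U ∩ H|` is shifted by `|e_v ∩ H| + |e_w ∩ H|`:

* §1 **`card_shellIn_full_full_filter`** — two full edges pinned, any predicate on the rest (eng g20's
  predicate-threaded one-edge pin `card_shellIn_full_filter`, twice);
  **`card_pin_two_eq_shellCount`** — `#{U ∈ Shell_S(t+4,c) : e_v,e_w ⊆ U, |U∩H| = x} = Sh_{S∖e_v∖e_w}(t,c; x − |e_v∩H| − |e_w∩H|)`.
* §2 the ratios: **`card_shellIn_sdiff_pair_ratio`** (`|S|·|Shell_{S∖e}(t,c)| = (t+2−c)·|Shell_S(t+2,c)|`, by double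
  counting the pairs (cut, full edge)) and **`card_shellIn_del2_full_ratio`**
  (`|S|(|S|−2)·|Shell_{S∖e∖e′}(t,c)| = (t+4−c)(t+2−c)·|Shell_S(t+4,c)|`): the probability that two given edges are
  full is `s(s−1)/(N(N−1))`, `s = (t+4−c)/2` the number of full edges — A POLYNOMIAL OF DEGREE `2` IN THE LEVEL `c`.
* §3 **`sum_shell_pin_two_eq`** — `Σ_{U ∈ Shell_S(t+4,c)} ψ(|U∩H|)·[e_v,e_w ⊆ U] = Σ_{U″ ∈ Shell_{S″}(t,c)} ψ(|U″∩H| + shift)`: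
  the tilted shell sum is an untilted shell sum of a SHIFTED profile on the deleted ground set; with §2 the
  tilted shell AVERAGE is `((t+4−c)(t+2−c)/(|S|(|S|−2)))·E_{Shell_{S″}(t,c)}[ψ(X″ + shift)]` (`shellAvg_pin_two_eq`).

So per matching the level profile of `ψ(|U∩H|)·x_vx_{πv}x_wx_{πw}` is (quadratic in `c`) × (a block-statistic
profile on a sub-matching), whose level differences the cell's `ShellLawSmoothing` / bricks 117–118 control
(discrete Leibniz; LIT-44 §7). All PROVED, 0 sorry, no named facts; bookkeeping on Rothvoß's slack-matrix
combinatorics. Cell pnp-psdrank (prover g21, MEMO-24 §3(a)).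

## References
* [Rothvoss2017] T. Rothvoß, J. ACM 64 (2017), §2 (PDF pp. 5–6).
* [GodsilMeagher2015] C. Godsil, K. Meagher, *Erdős–Ko–Rado Theorems: Algebraic Approaches*, §15.2.
-/

noncomputable section

open Finset

namespace Literature.Combinatorics.Optimization

namespace ShellStep

variable {n : ℕ} {π : Fin n → Fin n}

section Pin

variable (hπ : ∀ v, π (π v) = v) (hπ' : ∀ v, π v ≠ v)
include hπ hπ'

/-! ### §1 Two full edges pinned -/

/-- **Two full edges pinned, any predicate on the rest**: for `v, w ∈ S` on distinct edges,
`#{U ∈ Shell_S(t+4,c) : v,πv,w,πw ∈ U, Q(U ∖ e_v ∖ e_w)} = #{U″ ∈ Shell_{S∖e_v∖e_w}(t,c) : Q U″}`.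
[cite: Rothvoss2017, §2 (PDF p. 6)] -/
theorem card_shellIn_full_full_filter {S : Finset (Fin n)} (hS : ∀ u ∈ S, π u ∈ S) {v w : Fin n}
    (hv : v ∈ S) (hw : w ∈ S) (hwv : w ≠ v) (hwπ : w ≠ π v) (t c : ℕ) (Q : Finset (Fin n) → Prop)
    [DecidablePred Q] :
    ((shellIn π S (t + 4) c).filter fun U => v ∈ U ∧ π v ∈ U ∧ w ∈ U ∧ π w ∈ U ∧
        Q ((U \ {v, π v}) \ {w, π w})).card =
      ((shellIn π (del2 π S v w) t c).filter Q).card := by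
  have hπwv : π w ≠ v := fun h => hwπ (by rw [← h, hπ])
  have hπwπv : π w ≠ π v := fun h => hwv (by rw [← hπ w, h, hπ])
  have hw' : w ∈ S \ {v, π v} := by
    rw [mem_sdiff, mem_insert, mem_singleton, not_or]; exact ⟨hw, hwv, hwπ⟩
  -- first pin `e_v`
  have h1 := card_shellIn_full_filter hπ hπ' hS hv (t + 2) c
    (fun U' => w ∈ U' ∧ π w ∈ U' ∧ Q (U' \ {w, π w}))
  have e1 : ((shellIn π S (t + 4) c).filter fun U => v ∈ U ∧ π v ∈ U ∧ w ∈ U ∧ π w ∈ U ∧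
        Q ((U \ {v, π v}) \ {w, π w})) =
      ((shellIn π S (t + 2 + 2) c).filter fun U => v ∈ U ∧ π v ∈ U ∧
        (w ∈ U \ {v, π v} ∧ π w ∈ U \ {v, π v} ∧ Q ((U \ {v, π v}) \ {w, π w}))) := by
    rw [show t + 4 = t + 2 + 2 by ring]
    refine filter_congr fun U _ => ?_
    simp only [mem_sdiff, mem_insert, mem_singleton, not_or]
    tauto
  rw [e1, h1]
  -- then pin `e_w` inside `S ∖ e_v`
  have h2 := card_shellIn_full_filter hπ hπ' (sdiff_pair_stable hπ hS v) hw' t c Q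
  rw [← del2_eq_sdiff_sdiff] at h2
  exact h2

/-- **The pinned block-statistic count**: `#{U ∈ Shell_S(t+4,c) : v,πv,w,πw ∈ U, |U∩H| = x} =
Sh_{S∖e_v∖e_w}(t,c; x − |e_v∩H| − |e_w∩H|)`. [cite: Rothvoss2017, §2 (PDF p. 6)] -/
theorem card_pin_two_eq_shellCount {S : Finset (Fin n)} (hS : ∀ u ∈ S, π u ∈ S) (H : Finset (Fin n))
    {v w : Fin n} (hv : v ∈ S) (hw : w ∈ S) (hwv : w ≠ v) (hwπ : w ≠ π v) (t c : ℕ) (x : ℤ) :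
    (((shellIn π S (t + 4) c).filter fun U => v ∈ U ∧ π v ∈ U ∧ w ∈ U ∧ π w ∈ U ∧
        ((U ∩ H).card : ℤ) = x).card : ℝ) =
      shellCount π (del2 π S v w) H t c
        (x - (({v, π v} ∩ H).card : ℤ) - (({w, π w} ∩ H).card : ℤ)) := by
  have hπwv : π w ≠ v := fun h => hwπ (by rw [← h, hπ])
  have hπwπv : π w ≠ π v := fun h => hwv (by rw [← hπ w, h, hπ])
  have h := card_shellIn_full_full_filter hπ hπ' hS hv hw hwv hwπ t c
    (fun U'' : Finset (Fin n) => ((U'' ∩ H).card : ℤ) = x - (({v, π v} ∩ H).card : ℤ) - (({w, π w} ∩ H).card : ℤ))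
  have e : ((shellIn π S (t + 4) c).filter fun U => v ∈ U ∧ π v ∈ U ∧ w ∈ U ∧ π w ∈ U ∧
        ((U ∩ H).card : ℤ) = x) =
      ((shellIn π S (t + 4) c).filter fun U => v ∈ U ∧ π v ∈ U ∧ w ∈ U ∧ π w ∈ U ∧
        ((((U \ {v, π v}) \ {w, π w}) ∩ H).card : ℤ) = x - (({v, π v} ∩ H).card : ℤ) - (({w, π w} ∩ H).card : ℤ)) := by
    refine filter_congr fun U _ => ?_
    constructor
    · rintro ⟨hvU, hπvU, hwU, hπwU, hx⟩
      refine ⟨hvU, hπvU, hwU, hπwU, ?_⟩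
      have hw1 : w ∈ U \ {v, π v} := by
        rw [mem_sdiff, mem_insert, mem_singleton, not_or]; exact ⟨hwU, hwv, hwπ⟩
      have hw2 : π w ∈ U \ {v, π v} := by
        rw [mem_sdiff, mem_insert, mem_singleton, not_or]; exact ⟨hπwU, hπwv, hπwπv⟩
      rw [card_inter_sdiff_pair hw1 hw2 H, card_inter_sdiff_pair hvU hπvU H, hx]
    · rintro ⟨hvU, hπvU, hwU, hπwU, hx⟩
      refine ⟨hvU, hπvU, hwU, hπwU, ?_⟩
      have hw1 : w ∈ U \ {v, π v} := by
        rw [mem_sdiff, mem_insert, mem_singleton, not_or]; exact ⟨hwU, hwv, hwπ⟩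
      have hw2 : π w ∈ U \ {v, π v} := by
        rw [mem_sdiff, mem_insert, mem_singleton, not_or]; exact ⟨hπwU, hπwv, hπwπv⟩
      rw [card_inter_sdiff_pair hw1 hw2 H, card_inter_sdiff_pair hvU hπvU H] at hx
      omega
  rw [shellCount, ← h, e]

/-! ### §2 The pinning ratios: the probability that given edges are full is polynomial in the level -/

/-- **One-edge ratio**: `|S|·|Shell_{S∖e_v}(t,c)| = (t+2−c)·|Shell_S(t+2,c)|` (double count of the pairs
(cut, full vertex); all one-edge-deleted shells have the same size). [cite: Rothvoss2017, §2 (PDF p. 6)] -/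
theorem card_shellIn_sdiff_pair_ratio {S : Finset (Fin n)} (hS : ∀ u ∈ S, π u ∈ S) {v : Fin n}
    (hv : v ∈ S) (t c : ℕ) :
    (S.card : ℝ) * (shellIn π (S \ {v, π v}) t c).card = ((t : ℝ) + 2 - c) * (shellIn π S (t + 2) c).card := by
  -- Σ_{u ∈ S} #{U : u, πu ∈ U} = Σ_U |full U| = (t+2−c)|Shell|
  have hcount : ∀ u ∈ S, (((shellIn π S (t + 2) c).filter fun U => u ∈ U ∧ π u ∈ U).card : ℝ) =
      (shellIn π (S \ {v, π v}) t c).card := by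
    intro u hu
    rw [card_shellIn_full hπ hπ' hS hu t c]
    have e := card_shellIn_eq_of_card_eq hπ hπ' ((S \ {u, π u}).card) (S₁ := S \ {u, π u})
      (S₂ := S \ {v, π v}) rfl (by
        have h1 := card_sdiff_pair hπ' hS hu
        have h2 := card_sdiff_pair hπ' hS hv
        omega) (sdiff_pair_stable hπ hS u) (sdiff_pair_stable hπ hS v) t c
    exact_mod_cast e
  have hlhs : (S.card : ℝ) * (shellIn π (S \ {v, π v}) t c).card =
      ∑ u ∈ S, (((shellIn π S (t + 2) c).filter fun U => u ∈ U ∧ π u ∈ U).card : ℝ) := by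
    rw [sum_congr rfl hcount, sum_const, nsmul_eq_mul]
  rw [hlhs]
  -- swap the double count
  have hswap : ∑ u ∈ S, (((shellIn π S (t + 2) c).filter fun U => u ∈ U ∧ π u ∈ U).card : ℝ) =
      ∑ U ∈ shellIn π S (t + 2) c, ((full π U).card : ℝ) := by
    have eL : ∀ u ∈ S, (((shellIn π S (t + 2) c).filter fun U => u ∈ U ∧ π u ∈ U).card : ℝ) =
        ∑ U ∈ shellIn π S (t + 2) c, if (u ∈ U ∧ π u ∈ U) then (1 : ℝ) else 0 := by
      intro u _
      rw [card_filter]; push_cast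
      exact sum_congr rfl fun U _ => by split_ifs <;> simp
    have eR : ∀ U ∈ shellIn π S (t + 2) c, ((full π U).card : ℝ) =
        ∑ u ∈ S, if (u ∈ U ∧ π u ∈ U) then (1 : ℝ) else 0 := by
      intro U hU
      have hUS : U ⊆ S := (mem_shellIn.1 hU).1
      rw [full, card_filter]; push_cast
      rw [← sum_subset hUS (fun u _ huU => by rw [if_neg (fun h => huU h.1)])]
      refine sum_congr rfl fun u hu => ?_
      by_cases h : π u ∈ U
      · rw [if_pos h, if_pos ⟨hu, h⟩]
      · rw [if_neg h, if_neg (fun h' => h h'.2)]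
    rw [sum_congr rfl eL, sum_congr rfl eR, sum_comm]
  rw [hswap, sum_congr rfl fun U hU => by rw [card_full_of_mem_shellIn hU], sum_const, nsmul_eq_mul]
  have hct : ∀ U ∈ shellIn π S (t + 2) c, c ≤ t + 2 := fun U hU => le_of_mem_shellIn hU
  by_cases hne : (shellIn π S (t + 2) c).Nonempty
  · obtain ⟨U, hU⟩ := hne
    rw [Nat.cast_sub (hct U hU)]; push_cast; ring
  · rw [not_nonempty_iff_eq_empty.1 hne]; simp

/-- **Two-edge ratio**: `|S|(|S|−2)·|Shell_{S∖e_v∖e_w}(t,c)| = (t+4−c)(t+2−c)·|Shell_S(t+4,c)|` for `v, w` on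
distinct edges — the probability that two given edges of the matching are full under the uniform cut of
`Shell_S(t+4,c)` is `s(s−1)/(N(N−1))`, `s = (t+4−c)/2`, `N = |S|/2`: a quadratic polynomial in the level.
[cite: Rothvoss2017, §2 (PDF p. 6)] -/
theorem card_shellIn_del2_full_ratio {S : Finset (Fin n)} (hS : ∀ u ∈ S, π u ∈ S) {v w : Fin n}
    (hv : v ∈ S) (hw : w ∈ S) (hwv : w ≠ v) (hwπ : w ≠ π v) (t c : ℕ) :
    (S.card : ℝ) * ((S.card : ℝ) - 2) * (shellIn π (del2 π S v w) t c).card =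
      ((t : ℝ) + 4 - c) * ((t : ℝ) + 2 - c) * (shellIn π S (t + 4) c).card := by
  have hw' : w ∈ S \ {v, π v} := by
    rw [mem_sdiff, mem_insert, mem_singleton, not_or]; exact ⟨hw, hwv, hwπ⟩
  have h1 := card_shellIn_sdiff_pair_ratio hπ hπ' hS hv (t + 2) c
  have h2 := card_shellIn_sdiff_pair_ratio hπ hπ' (sdiff_pair_stable hπ hS v) hw' t c
  rw [← del2_eq_sdiff_sdiff] at h2
  have hc : ((S \ {v, π v}).card : ℝ) = (S.card : ℝ) - 2 := by
    have := card_sdiff_pair hπ' hS hv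
    have : ((S \ {v, π v}).card : ℝ) + 2 = S.card := by exact_mod_cast this
    linarith
  rw [hc] at h2
  rw [show t + 2 + 2 = t + 4 by ring] at h1
  push_cast at h1 h2
  calc (S.card : ℝ) * ((S.card : ℝ) - 2) * (shellIn π (del2 π S v w) t c).card
      = (S.card : ℝ) * (((S.card : ℝ) - 2) * (shellIn π (del2 π S v w) t c).card) := by ring
    _ = (S.card : ℝ) * (((t : ℝ) + 2 - c) * (shellIn π (S \ {v, π v}) (t + 2) c).card) := by rw [h2]
    _ = ((t : ℝ) + 2 - c) * ((S.card : ℝ) * (shellIn π (S \ {v, π v}) (t + 2) c).card) := by ring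
    _ = ((t : ℝ) + 2 - c) * (((t : ℝ) + 4 - c) * (shellIn π S (t + 4) c).card) := by
        rw [h1]; ring
    _ = _ := by ring

/-! ### §3 The tilted shell sum is an untilted shell sum of a shifted profile on the deleted ground set -/

/-- **Pinned shell sum**: `Σ_{U ∈ Shell_S(t+4,c), e_v,e_w ⊆ U} ψ(|U∩H|) = Σ_{U″ ∈ Shell_{S∖e_v∖e_w}(t,c)} ψ(|U″∩H| + |e_v∩H| + |e_w∩H|)`.
[cite: Rothvoss2017, §2 (PDF p. 6)] -/
theorem sum_shell_pin_two_eq {S : Finset (Fin n)} (hS : ∀ u ∈ S, π u ∈ S) (H : Finset (Fin n))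
    {v w : Fin n} (hv : v ∈ S) (hw : w ∈ S) (hwv : w ≠ v) (hwπ : w ≠ π v) (t c : ℕ) (ψ : ℤ → ℝ) :
    ∑ U ∈ (shellIn π S (t + 4) c).filter (fun U => v ∈ U ∧ π v ∈ U ∧ w ∈ U ∧ π w ∈ U),
        ψ ((U ∩ H).card : ℤ) =
      ∑ U'' ∈ shellIn π (del2 π S v w) t c,
        ψ (((U'' ∩ H).card : ℤ) + (({v, π v} ∩ H).card : ℤ) + (({w, π w} ∩ H).card : ℤ)) := by
  set σ : ℤ := (({v, π v} ∩ H).card : ℤ) + (({w, π w} ∩ H).card : ℤ) with hσ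
  -- fiberwise on both sides over the value of `|U ∩ H|`
  set Win : Finset ℤ := Icc (0 : ℤ) ((t : ℤ) + 4) with hWin
  have hmapsL : ∀ U ∈ (shellIn π S (t + 4) c).filter (fun U => v ∈ U ∧ π v ∈ U ∧ w ∈ U ∧ π w ∈ U),
      ((U ∩ H).card : ℤ) ∈ Win := by
    intro U hU
    have hU' := (mem_filter.1 hU).1
    rw [hWin, mem_Icc]
    refine ⟨by positivity, ?_⟩
    have h1 : (U ∩ H).card ≤ U.card := card_le_card inter_subset_left
    have h2 : U.card = t + 4 := (mem_shellIn.1 hU').2.1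
    have : ((U ∩ H).card : ℤ) ≤ ((t + 4 : ℕ) : ℤ) := by exact_mod_cast h2 ▸ h1
    push_cast at this; exact this
  have hmapsR : ∀ U'' ∈ shellIn π (del2 π S v w) t c, ((U'' ∩ H).card : ℤ) + σ ∈ Win := by
    intro U'' hU''
    rw [hWin, mem_Icc]
    refine ⟨by positivity, ?_⟩
    have h1 : (U'' ∩ H).card ≤ U''.card := card_le_card inter_subset_left
    have h2 : U''.card = t := (mem_shellIn.1 hU'').2.1
    have h3 : ({v, π v} ∩ H).card ≤ 2 := (card_le_card inter_subset_left).trans (card_insert_le _ _)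
    have h4 : ({w, π w} ∩ H).card ≤ 2 := (card_le_card inter_subset_left).trans (card_insert_le _ _)
    have : ((U'' ∩ H).card : ℤ) ≤ t := by exact_mod_cast h2 ▸ h1
    have h3' : (({v, π v} ∩ H).card : ℤ) ≤ 2 := by exact_mod_cast h3
    have h4' : (({w, π w} ∩ H).card : ℤ) ≤ 2 := by exact_mod_cast h4
    rw [hσ]; linarith
  rw [← sum_fiberwise_of_maps_to hmapsL, ← sum_fiberwise_of_maps_to hmapsR]
  refine sum_congr rfl fun x _ => ?_
  -- left fiber: `ψ x · #{pinned, X = x}`; right fiber: `ψ x · Sh''(x − σ)`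
  have hL : ∑ U ∈ ((shellIn π S (t + 4) c).filter (fun U => v ∈ U ∧ π v ∈ U ∧ w ∈ U ∧ π w ∈ U)).filter
        (fun U => ((U ∩ H).card : ℤ) = x), ψ ((U ∩ H).card : ℤ) =
      ψ x * (((shellIn π S (t + 4) c).filter fun U => v ∈ U ∧ π v ∈ U ∧ w ∈ U ∧ π w ∈ U ∧
        ((U ∩ H).card : ℤ) = x).card : ℝ) := by
    rw [filter_filter]
    have e : ((shellIn π S (t + 4) c).filter fun U => (v ∈ U ∧ π v ∈ U ∧ w ∈ U ∧ π w ∈ U) ∧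
          ((U ∩ H).card : ℤ) = x) =
        ((shellIn π S (t + 4) c).filter fun U => v ∈ U ∧ π v ∈ U ∧ w ∈ U ∧ π w ∈ U ∧
          ((U ∩ H).card : ℤ) = x) := filter_congr fun U _ => by tauto
    rw [e, mul_comm, ← nsmul_eq_mul, ← sum_const]
    refine sum_congr rfl fun U hU => ?_
    rw [(mem_filter.1 hU).2.2.2.2.2]
  have hR : ∑ U'' ∈ (shellIn π (del2 π S v w) t c).filter (fun U'' => ((U'' ∩ H).card : ℤ) + σ = x),
        ψ (((U'' ∩ H).card : ℤ) + σ) =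
      ψ x * shellCount π (del2 π S v w) H t c (x - σ) := by
    rw [shellCount]
    have e : ((shellIn π (del2 π S v w) t c).filter fun U'' => ((U'' ∩ H).card : ℤ) + σ = x) =
        ((shellIn π (del2 π S v w) t c).filter fun U'' => ((U'' ∩ H).card : ℤ) = x - σ) :=
      filter_congr fun U _ => by omega
    rw [e, mul_comm, ← nsmul_eq_mul, ← sum_const]
    refine sum_congr rfl fun U hU => ?_
    rw [(mem_filter.1 hU).2, sub_add_cancel]
  have hRw : ∑ U'' ∈ (shellIn π (del2 π S v w) t c).filter (fun U'' => ((U'' ∩ H).card : ℤ) + σ = x),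
        ψ (((U'' ∩ H).card : ℤ) + (({v, π v} ∩ H).card : ℤ) + (({w, π w} ∩ H).card : ℤ)) =
      ∑ U'' ∈ (shellIn π (del2 π S v w) t c).filter (fun U'' => ((U'' ∩ H).card : ℤ) + σ = x),
        ψ (((U'' ∩ H).card : ℤ) + σ) := by
    refine sum_congr rfl fun U _ => ?_
    rw [hσ, add_assoc]
  rw [hL, hRw, hR, card_pin_two_eq_shellCount hπ hπ' hS H hv hw hwv hwπ t c x, hσ]
  ring_nf

/-- **Pinned shell average**: for `Shell_S(t+4,c) ≠ ∅`,
`(Σ_{U ∈ Shell_S(t+4,c), e_v,e_w ⊆ U} ψ(|U∩H|)) / |Shell_S(t+4,c)| =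
((t+4−c)(t+2−c)/(|S|(|S|−2))) · (Σ_{U″ ∈ Shell_{S″}(t,c)} ψ(|U″∩H| + shift)) / |Shell_{S″}(t,c)|`
(`S″ = S ∖ e_v ∖ e_w`): the tilted average is a quadratic-in-`c` multiple of an untilted shell average of a shifted
profile on the deleted ground set. [cite: Rothvoss2017, §2 (PDF p. 6)] [cite: GodsilMeagher2015, §15.2] -/
theorem shellAvg_pin_two_eq {S : Finset (Fin n)} (hS : ∀ u ∈ S, π u ∈ S) (H : Finset (Fin n))
    {v w : Fin n} (hv : v ∈ S) (hw : w ∈ S) (hwv : w ≠ v) (hwπ : w ≠ π v) (t c : ℕ) (ψ : ℤ → ℝ)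
    (hne : (shellIn π S (t + 4) c).Nonempty) :
    (∑ U ∈ (shellIn π S (t + 4) c).filter (fun U => v ∈ U ∧ π v ∈ U ∧ w ∈ U ∧ π w ∈ U),
        ψ ((U ∩ H).card : ℤ)) / ((shellIn π S (t + 4) c).card : ℝ) =
      (((t : ℝ) + 4 - c) * ((t : ℝ) + 2 - c) / ((S.card : ℝ) * ((S.card : ℝ) - 2))) *
        ((∑ U'' ∈ shellIn π (del2 π S v w) t c,
            ψ (((U'' ∩ H).card : ℤ) + (({v, π v} ∩ H).card : ℤ) + (({w, π w} ∩ H).card : ℤ))) /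
          ((shellIn π (del2 π S v w) t c).card : ℝ)) := by
  rw [sum_shell_pin_two_eq hπ hπ' hS H hv hw hwv hwπ t c ψ]
  have hr := card_shellIn_del2_full_ratio hπ hπ' hS hv hw hwv hwπ t c
  have hS6 : t + 4 + c ≤ S.card := by obtain ⟨U, hU⟩ := hne; exact add_le_of_mem_shellIn hπ hS hU
  have h4 : (4 : ℝ) ≤ S.card := by
    have : 4 ≤ S.card := by omega
    exact_mod_cast this
  have hden : 0 < (S.card : ℝ) * ((S.card : ℝ) - 2) := mul_pos (by linarith) (by linarith)
  have hA : (0 : ℝ) < (shellIn π S (t + 4) c).card := by exact_mod_cast hne.card_pos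
  by_cases hB : shellIn π (del2 π S v w) t c = ∅
  · simp [hB]
  have hBpos : (0 : ℝ) < (shellIn π (del2 π S v w) t c).card := by
    exact_mod_cast (nonempty_iff_ne_empty.2 hB).card_pos
  rw [div_mul_div_comm, div_eq_div_iff hA.ne' (mul_ne_zero hden.ne' hBpos.ne')]
  linear_combination (∑ U'' ∈ shellIn π (del2 π S v w) t c,
    ψ (((U'' ∩ H).card : ℤ) + (({v, π v} ∩ H).card : ℤ) + (({w, π w} ∩ H).card : ℤ))) * hr

end Pin

end ShellStep

end Literature.Combinatorics.Optimization

end
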